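import Summits.ABC.IUTFork.Thm311RealLog
import Summits.ABC.IUTFork.Thm311Pilot
import Literature.IUT.HodgeArakelov.AbsTopMonoidsGenuineIsometries
import Literature.IUT.HodgeArakelov.KummerStructuresIsometryNorms
import Literature.NumberTheory.Automorphic.AdicCompletionLocalField
import Literature.NumberTheory.GaloisRepresentations.LocalGlobalCohomologyFiniteProofs
import HarnessLib

/-!
# [IUTchIII] Theorem 3.11 (i) (Ind2) at `v_ℚ ∈ 𝕍^non_ℚ`, PRINT-LITERAL: the indeterminacies induced on the real
# log-shell `K_v` by [IUTchII] Example 1.8 (iv)'s `G_v`-ISOMETRIES of `k~ = 𝒪_{K̄_v}^× ⧸ μ` — they ACT THROUGH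
# Dupuy–Hilado's lattice automorphisms (`⊆ Real.ismDH`)

Record file (D-0012) of the abc-iut cell (Cor. 3.12 sub-crew, seat abc-iut-c312-1 = holder of record of the typed
[IUTchIII] Thm. 3.11, gen 7); TAKES NO SIDE on [IUTchIII] Cor. 3.12.

THE BINDER IT REPLACES.  abc-iut-c312-5's real signature `Real.logShells X logv Aut Ism …` leaves the (Ind2)-slot `Ism` a
BINDER; its Dupuy–Hilado instance `Real.ismDH logv` (`Thm311RealDH`) is, at a finite place, DH §4.9's `Aut_{ℚ_p}(K_v : I_v)`
— the bicontinuous `ℚ`-linear `φ` with `φ(I_v) = I_v` — and RECORDS as RESIDUAL «the M-level `Ism` ([IUTchII] Ex. 1.8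
(iv), `G_v`-isometries of `O^{×μ}`) … remain the binders».  Print, [IUTchIII] Thm. 3.11 (i) (Ind2) (kurims p. 154 l.
55–60, cell render `IUTchIII-kurims-url-4b091feeb646`): "for each `v_ℚ ∈ 𝕍^non_ℚ` … the indeterminacies induced by the
action of independent copies of Ism [cf. Proposition 1.2, (vi)] … on each of the direct summands of the `j+1` factors";
Prop. 1.2 (vi) (p. 32 l. 40–45): "an Ism-orbit of isomorphisms [cf. [IUTchII], Example 1.8, (iv); [IUTchII], Definition
4.9, (i), (vii)] `log(†𝒟⊢_v) ⥲ log(†𝔉^{⊢×μ}_v)`"; [IUTchII] Ex. 1.8 (iv) (kurims p. 39): "`Ism(G)` … the compact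
topological group of `G`-isometries of `O^{×μ}(G)`, i.e., `G`-equivariant automorphisms of the ind-topological module
`O^{×μ}(G)` that, for each open subgroup `H ⊆ G`, preserve the lattice in `O^{×μ}(G)^H` determined by the image of
`O^×(G)^H`"; Dupuy–Hilado arXiv:2004.13228 §4.9: these indeterminacies "act through the group `Aut_{ℚ_p}(K_v : I_v)`".

TYPED (every constant a landed tree decl; no `Prop` fact): `Real.closureAt v` (`(K_v, K̄_v)`, `K̄_v := AlgebraicClosure
K_v`, abc-iut-L4-t2's `MLFClosure`; `K_v` a non-archimedean local field by the tree's instance); `Real.galRho v`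
(abc-iut-L6-d2's Galois-type action `Genuine.unitsActionOf` of `G_v` on `O^×(G_v) = (𝒪^⊳_{K̄_v})ˣ`); **`Real.ismGenuine v
:= isometryGroup (galRho v) (openSubgroups v)`** — PRINT'S `Ism(G_v)` (abc-iut-L6-t2's `isometryGroup`) for the GENUINE
pair; `Real.clsOf v u` (class of `u ∈ 𝒪_v^×` in `O^{×μ}`); `Real.Realises v L φ ψ` ("`ψ : K_v ⥲ K_v` is induced by `φ`
through the logarithm `L` on `𝒪_v^×`": `φ[u] = [u'] ⟹ ψ(L u) = L u'` — the passage `Ism ↷ O^{×μ}(G_v) ⊇ O^{×μ}(G_v)^{G_v} =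
𝒪_v^×⧸μ —log→ I_v ⊆ K_v = log(G_v)^{G_v}` of Prop. 1.2 (vi) / [AbsTopIII] Prop. 5.8 (ii)); **`Real.ismIsmOf v L`** /
**`Real.ismIsm logv v`** — the (Ind2)-group PRINT names at a finite place: the bicontinuous automorphisms of `K_v`
realising some `φ ∈ Ism(G_v)` (continuity is print's "ind-topological"), read on c312-5's carrier.

PROVED: `Real.mem_fixedBy_top_iff` (`O^×(G_v)^{G_v} = 𝒪_v^×`: abc-iut-L4's `mem_invariantUnits_iff`); `Real.log_eq_of_clsOf_eq`;
**`Real.ismIsm_subset_ismDH`** — PRINT'S (Ind2) ACTS THROUGH DUPUY–HILADO'S: every realised isometry maps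
`I_v = (p_v^*)⁻¹·log_v(𝒪_v^×)` onto itself (the lattice condition at `H = G_v` + `G_v`-equivariance), hence lies in
`Real.ismDH logv (inr v)` — DH §4.9 «act through» as a kernel theorem.  CONSEQUENCE for the adjudication (sequel
`Thm311RealInd2IsmSignature`: signature + packet-level monotonicity): every statement of record quantifying UNIVERSALLY
over `ismDH` and every countermodel whose hull/orbit is formed over `ismDH` transfers verbatim to print's group;
`Real.refl_mem_ismIsm`, **`Real.neg_mem_ismIsm`** — non-vacuity (`−1`, this lineage's `invAut_mem_isometryGroup`).
A second sequel proves the converse-direction rigidity (norm lattices + the tree's local existence theorem ⇒ print's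
isometries FIX every finite-index sub-lattice of `log_v(𝒪_v^×)` — no (Ind2)-inflation of lattice regions under print).

HONEST SCOPE: a statement about OUR typed objects; (Ind1)'s strip part (`stripAutDH = {1}`) and the `p_v`-adic-log
binder are untouched; Mochizuki's `Ism` is typed with topologies suppressed (abc-iut-L6-t2) — the realisation adds back
exactly the continuity print's "ind-topological" carries; nothing here asserts or refutes [IUTchIII] Cor. 3.12.
[claim: Mochizuki2012, status: disputed] for every quotation; [cite: DupuyHilado2025, §4.9]. typed ≠ proved.
-/

set_option autoImplicit false

noncomputable section

namespace Summit.ABC.IUTFork.Thm311.Real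

open NumberField IsDedekindDomain Literature.IUT.LogVolume Literature.IUT.LogThetaLattice
open Literature.AnabelianGeometry.AbsoluteAnabelian Literature.IUT.HodgeArakelov
open Literature.IUT.HodgeArakelov.AbsTopMonoids Literature.NumberTheory

variable {F : Type} [Field F] [NumberField F]

/-! ## 1. The genuine Galois pair at a finite place and print's `Ism(G_v)`

Everything in §§1–3 is typed on Mathlib's names `v.adicCompletion F` / `v.adicCompletionIntegers F` of the carrier
(c312-5's `Real.Carrier (inr v)` / `Real.integers v` are these by `rfl`; `CharZero K_v` is the tree's
`GaloisRepresentations.charZero_adicCompletion`, fed explicitly — no instance declared); the sequel reads the results on c312-5's signature. -/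

/-- `(K_v, K̄_v)` as abc-iut-L4-t2's container: `K_v = v.adicCompletion F` (a non-archimedean local field — the
tree's `instIsNonarchimedeanLocalFieldAdicCompletion`) with ITS algebraic closure `K̄_v := AlgebraicClosure K_v`
(the closure over which the tree's local existence theorem is stated). Reducible, so that `(closureAt v).k` is
`K_v` for instance search. [cite: MochizukiAbsTopIII2015, Definition 3.1 (i) p.66] -/
abbrev closureAt (v : HeightOneSpectrum (𝓞 F)) : MLFClosure.{0} :=
  { k := v.adicCompletion F
    instChar := GaloisRepresentations.charZero_adicCompletion v
    K := AlgebraicClosure (v.adicCompletion F) }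

/-- `G_v := Gal(K̄_v/K_v)` (Mathlib's `K̄_v ≃ₐ[K_v] K̄_v`, Krull topology). [folklore] -/
abbrev Gal (v : HeightOneSpectrum (𝓞 F)) : Type :=
  AlgebraicClosure (v.adicCompletion F) ≃ₐ[v.adicCompletion F] AlgebraicClosure (v.adicCompletion F)

/-- `O^×(G_v) := (𝒪^⊳_{K̄_v})ˣ` (units of abc-iut-L4-t2's non-zero integers of `K̄_v`). [cite: MochizukiAbsTopIII2015, Definition 3.1 (i) p.66] -/
abbrev OUnits (v : HeightOneSpectrum (𝓞 F)) : Type :=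
  (nonzeroIntegers (v.adicCompletion F) (AlgebraicClosure (v.adicCompletion F)))ˣ

/-- The Galois-type action `G_v ↷ O^×(G_v)` (abc-iut-L6-d2's `Genuine.unitsActionOf` through the identity of
`G_v`): `σ` acts on a unit by the field automorphism `σ`. [claim: Mochizuki2012, status: disputed] -/
def galRho (v : HeightOneSpectrum (𝓞 F)) : Gal v →* MulAut (OUnits v) :=
  Genuine.unitsActionOf (closureAt v) (MonoidHom.id (Gal v))

/-- Unfolding: `γ` acts through the field automorphism `γ` on underlying elements of `K̄_v`. [folklore] -/
theorem coe_galRho (v : HeightOneSpectrum (𝓞 F)) (γ : Gal v) (x : OUnits v) :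
    (((galRho v γ x : OUnits v) : nonzeroIntegers (v.adicCompletion F) (AlgebraicClosure (v.adicCompletion F))) :
      AlgebraicClosure (v.adicCompletion F)) =
      γ (((x : nonzeroIntegers (v.adicCompletion F) (AlgebraicClosure (v.adicCompletion F))) :
        AlgebraicClosure (v.adicCompletion F))) :=
  Genuine.coe_unitsActionOf (closureAt v) (MonoidHom.id (Gal v)) γ x

/-- "for each open subgroup `H ⊆ G`" ([IUTchII] Ex. 1.8 (iv) p. 39): Krull-open subgroups of `G_v`. [claim: Mochizuki2012, status: disputed] -/
def openSubgroups (v : HeightOneSpectrum (𝓞 F)) : Set (Subgroup (Gal v)) := {H | IsOpen (H : Set (Gal v))}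

/-- `G_v` is open in itself. [folklore] -/
theorem top_mem_openSubgroups (v : HeightOneSpectrum (𝓞 F)) : (⊤ : Subgroup (Gal v)) ∈ openSubgroups v := by
  change IsOpen ((⊤ : Subgroup (Gal v)) : Set (Gal v))
  rw [Subgroup.coe_top]
  exact isOpen_univ

/-- **PRINT'S `Ism(G_v)`** ([IUTchII] Ex. 1.8 (iv) p. 39; [IUTchIII] Prop. 1.2 (vi), Thm. 3.11 (i) (Ind2)): the
`G_v`-equivariant automorphisms of `O^{×μ}(G_v) = (𝒪^⊳_{K̄_v})ˣ ⧸ μ` preserving, for every OPEN `H ⊆ G_v`, the lattice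
`Im(O^×(G_v)^H)` — abc-iut-L6-t2's `isometryGroup` for the GENUINE pair at `v` (topologies suppressed there; the
realisation below restores continuity). [claim: Mochizuki2012, status: disputed] -/
def ismGenuine (v : HeightOneSpectrum (𝓞 F)) : Subgroup (MulAut (ModTorsion (OUnits v))) :=
  isometryGroup (galRho v) (openSubgroups v)

/-! ## 2. Units of `𝒪_v` inside `O^×(G_v)`, and their classes -/

section Units

variable (v : HeightOneSpectrum (𝓞 F))

/-- A unit of `𝒪_v` has `|u|_v = 1`. [folklore] -/
theorem valued_coe_unit (u : (↥(v.adicCompletionIntegers F))ˣ) :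
    Valued.v ((u : ↥(v.adicCompletionIntegers F)) : v.adicCompletion F) = 1 := by
  have hu : Valued.v ((u : ↥(v.adicCompletionIntegers F)) : v.adicCompletion F) ≤ 1 :=
    (u : ↥(v.adicCompletionIntegers F)).2
  have hu' : Valued.v (((u⁻¹ : (↥(v.adicCompletionIntegers F))ˣ) : ↥(v.adicCompletionIntegers F)) :
      v.adicCompletion F) ≤ 1 :=
    ((u⁻¹ : (↥(v.adicCompletionIntegers F))ˣ) : ↥(v.adicCompletionIntegers F)).2
  have hmul : Valued.v ((u : ↥(v.adicCompletionIntegers F)) : v.adicCompletion F) *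
      Valued.v (((u⁻¹ : (↥(v.adicCompletionIntegers F))ˣ) : ↥(v.adicCompletionIntegers F)) : v.adicCompletion F) = 1 := by
    have h1 : ((u * u⁻¹ : (↥(v.adicCompletionIntegers F))ˣ) : ↥(v.adicCompletionIntegers F)) = 1 := by
      rw [mul_inv_cancel, Units.val_one]
    have h2 := congrArg (fun w : ↥(v.adicCompletionIntegers F) => Valued.v (w : v.adicCompletion F)) h1
    simpa only [Units.val_mul, MulMemClass.coe_mul, OneMemClass.coe_one, map_mul, map_one] using h2
  refine le_antisymm hu ?_
  calc (1 : WithZero (Multiplicative ℤ)) = _ * _ := hmul.symm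
    _ ≤ Valued.v ((u : ↥(v.adicCompletionIntegers F)) : v.adicCompletion F) * 1 := mul_le_mul_right hu' _
    _ = _ := mul_one _

/-- A unit of `𝒪_v` has valuation `1` for the valuative relation of `K_v` (that of `Valued.v`). [folklore] -/
theorem valuation_coe_unit (u : (↥(v.adicCompletionIntegers F))ˣ) :
    ValuativeRel.valuation (v.adicCompletion F) ((u : ↥(v.adicCompletionIntegers F)) : v.adicCompletion F) = 1 :=
  ((ValuativeRel.isEquiv (ValuativeRel.valuation (v.adicCompletion F))
    (Valued.v : Valuation (v.adicCompletion F) (WithZero (Multiplicative ℤ)))).eq_one_iff_eq_one).mpr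
    (valued_coe_unit v u)

/-- The unit of `𝒪_{K̄_v}` (abc-iut-L4's `unitGroup`) given by `u ∈ 𝒪_v^×` under `K_v → K̄_v`. [cite: MochizukiAbsTopIII2015, Definition 3.1 (iv) p.69] -/
def unitOfIntegers (u : (↥(v.adicCompletionIntegers F))ˣ) :
    unitGroup (v.adicCompletion F) (AlgebraicClosure (v.adicCompletion F)) :=
  ⟨Units.mk0 (algebraMap (v.adicCompletion F) (AlgebraicClosure (v.adicCompletion F))
      ((u : ↥(v.adicCompletionIntegers F)) : v.adicCompletion F))
      (ne_zero_of_mem_unitSubmonoid (algebraMap_mem_invariantUnits (v.adicCompletion F)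
        (AlgebraicClosure (v.adicCompletion F)) (valuation_coe_unit v u)).1),
    (algebraMap_mem_invariantUnits (v.adicCompletion F) (AlgebraicClosure (v.adicCompletion F))
      (valuation_coe_unit v u)).1⟩

/-- `unitOfIntegers v u = algebraMap K_v K̄_v u` underneath. [folklore] -/
@[simp] theorem coe_unitOfIntegers (u : (↥(v.adicCompletionIntegers F))ˣ) :
    (((unitOfIntegers v u : unitGroup (v.adicCompletion F) (AlgebraicClosure (v.adicCompletion F))) :
      (AlgebraicClosure (v.adicCompletion F))ˣ) : AlgebraicClosure (v.adicCompletion F)) =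
      algebraMap (v.adicCompletion F) (AlgebraicClosure (v.adicCompletion F))
        ((u : ↥(v.adicCompletionIntegers F)) : v.adicCompletion F) := rfl

/-- `unitOfIntegers` is a homomorphism `𝒪_v^× → 𝒪_{K̄_v}^×`. [folklore] -/
def unitOfIntegersHom :
    (↥(v.adicCompletionIntegers F))ˣ →* unitGroup (v.adicCompletion F) (AlgebraicClosure (v.adicCompletion F)) where
  toFun := unitOfIntegers v
  map_one' := Subtype.ext <| Units.ext <| by
    rw [coe_unitOfIntegers, Units.val_one, OneMemClass.coe_one, map_one]; rfl
  map_mul' a b := Subtype.ext <| Units.ext <| by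
    rw [coe_unitOfIntegers, Units.val_mul, MulMemClass.coe_mul, map_mul]; rfl

/-- `unitOfIntegersHom v u = unitOfIntegers v u`. [folklore] -/
@[simp] theorem unitOfIntegersHom_apply (u : (↥(v.adicCompletionIntegers F))ˣ) :
    unitOfIntegersHom v u = unitOfIntegers v u := rfl

/-- `unitOfIntegers` is injective (`K_v → K̄_v` is). [folklore] -/
theorem unitOfIntegers_injective : Function.Injective (unitOfIntegers (F := F) v) := by
  intro a b h
  have h' := congrArg (fun w : unitGroup (v.adicCompletion F) (AlgebraicClosure (v.adicCompletion F)) =>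
    ((w : (AlgebraicClosure (v.adicCompletion F))ˣ) : AlgebraicClosure (v.adicCompletion F))) h
  simp only [coe_unitOfIntegers] at h'
  exact Units.ext (Subtype.ext ((algebraMap (v.adicCompletion F) (AlgebraicClosure (v.adicCompletion F))).injective h'))

/-- **The class `[u] ∈ O^{×μ}(G_v)`** of a unit `u ∈ 𝒪_v^×`: through abc-iut-L6-d2's bridge `(𝒪^⊳_{K̄_v})ˣ ≅ 𝒪_{K̄_v}^×`
and the quotient by torsion. [claim: Mochizuki2012, status: disputed] -/
def clsOf (u : (↥(v.adicCompletionIntegers F))ˣ) : ModTorsion (OUnits v) :=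
  QuotientGroup.mk ((Genuine.unitsBridge (closureAt v)).symm (unitOfIntegers v u))

/-- The homomorphism `𝒪_v^× → O^×(G_v)` behind `clsOf`. [folklore] -/
def toOUnits : (↥(v.adicCompletionIntegers F))ˣ →* OUnits v :=
  (Genuine.unitsBridge (closureAt v)).symm.toMonoidHom.comp (unitOfIntegersHom v)

/-- `clsOf v u = [toOUnits v u]`. [folklore] -/
theorem clsOf_eq_mk (u : (↥(v.adicCompletionIntegers F))ˣ) : clsOf v u = QuotientGroup.mk (toOUnits v u) := rfl

/-- `toOUnits` is injective. [folklore] -/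
theorem toOUnits_injective : Function.Injective (toOUnits (F := F) v) :=
  (Genuine.unitsBridge (closureAt v)).symm.injective.comp (unitOfIntegers_injective v)

/-- `clsOf` is a homomorphism. [folklore] -/
theorem clsOf_mul (a b : (↥(v.adicCompletionIntegers F))ˣ) : clsOf v (a * b) = clsOf v a * clsOf v b := by
  rw [clsOf_eq_mk, clsOf_eq_mk, clsOf_eq_mk, map_mul, QuotientGroup.mk_mul]

/-- `clsOf v u⁻¹ = (clsOf v u)⁻¹`. [folklore] -/
theorem clsOf_inv (a : (↥(v.adicCompletionIntegers F))ˣ) : clsOf v a⁻¹ = (clsOf v a)⁻¹ := by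
  rw [clsOf_eq_mk, clsOf_eq_mk, map_inv, QuotientGroup.mk_inv]

/-- `u ∈ 𝒪_v^×` is fixed by all of `G_v` inside `O^×(G_v)`. [cite: MochizukiAbsTopIII2015, Definition 3.1 (iv) p.69] -/
theorem toOUnits_mem_fixedBy_top (u : (↥(v.adicCompletionIntegers F))ˣ) : toOUnits v u ∈ fixedBy (galRho v) ⊤ := by
  rw [mem_fixedBy]
  intro σ _
  apply Units.ext; apply Subtype.ext
  rw [coe_galRho]
  change σ ((((Genuine.unitsBridge (closureAt v)).symm (unitOfIntegers v u) : OUnits v) :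
    nonzeroIntegers (v.adicCompletion F) (AlgebraicClosure (v.adicCompletion F))) : AlgebraicClosure (v.adicCompletion F)) = _
  rw [Genuine.coe_unitsBridge_symm, coe_unitOfIntegers]
  exact σ.commutes _

/-- **`O^×(G_v)^{G_v} = 𝒪_v^×`**: an element of `(𝒪^⊳_{K̄_v})ˣ` is fixed by ALL of `G_v` iff it is (the image of) a unit
of `𝒪_v` — abc-iut-L4's `mem_invariantUnits_iff` (Galois descent in characteristic `0` + integral closedness of
`𝒪_v`). [cite: MochizukiAbsTopIII2015, Definition 3.1 (iv) p.69] -/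
theorem mem_fixedBy_top_iff (x : OUnits v) :
    x ∈ fixedBy (galRho v) ⊤ ↔ ∃ u : (↥(v.adicCompletionIntegers F))ˣ, x = toOUnits v u := by
  haveI := GaloisRepresentations.charZero_adicCompletion v
  constructor
  · intro hx
    have hval : (((Genuine.unitsBridge (closureAt v) x : unitGroup _ _) : (AlgebraicClosure (v.adicCompletion F))ˣ) :
        AlgebraicClosure (v.adicCompletion F)) ∈
          invariantUnits (v.adicCompletion F) (AlgebraicClosure (v.adicCompletion F)) := by
      refine ⟨(Genuine.unitsBridge (closureAt v) x).2, fun σ => ?_⟩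
      have h := hx σ (Subgroup.mem_top σ)
      have h' := congrArg (fun y : OUnits v =>
        ((y : nonzeroIntegers (v.adicCompletion F) (AlgebraicClosure (v.adicCompletion F))) :
          AlgebraicClosure (v.adicCompletion F))) h
      simp only [coe_galRho] at h'
      rw [AlgEquiv.smul_def, Genuine.coe_unitsBridge]
      exact h'
    obtain ⟨a, ha, hax⟩ := (mem_invariantUnits_iff (v.adicCompletion F) (AlgebraicClosure (v.adicCompletion F))).mp hval
    -- `a ∈ K_v` has valuation `1`: it is a unit of `𝒪_v`
    have ha1 : Valued.v a = 1 :=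
      ((ValuativeRel.isEquiv (ValuativeRel.valuation (v.adicCompletion F))
        (Valued.v : Valuation (v.adicCompletion F) (WithZero (Multiplicative ℤ)))).eq_one_iff_eq_one).mp ha
    have haO : a ∈ v.adicCompletionIntegers F := by
      rw [HeightOneSpectrum.mem_adicCompletionIntegers]; exact ha1.le
    have ha0 : a ≠ 0 := by
      intro h; rw [h, map_zero] at ha1; exact zero_ne_one ha1
    have haiO : a⁻¹ ∈ v.adicCompletionIntegers F := by
      rw [HeightOneSpectrum.mem_adicCompletionIntegers, map_inv₀, ha1, inv_one]
    let u : (↥(v.adicCompletionIntegers F))ˣ :=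
      ⟨⟨a, haO⟩, ⟨a⁻¹, haiO⟩, Subtype.ext (mul_inv_cancel₀ ha0), Subtype.ext (inv_mul_cancel₀ ha0)⟩
    refine ⟨u, ?_⟩
    apply (Genuine.unitsBridge (closureAt v)).injective
    change _ = Genuine.unitsBridge (closureAt v) ((Genuine.unitsBridge (closureAt v)).symm (unitOfIntegers v u))
    rw [MulEquiv.apply_symm_apply]
    apply Subtype.ext; apply Units.ext
    rw [coe_unitOfIntegers]
    exact hax.symm
  · rintro ⟨u, rfl⟩
    exact toOUnits_mem_fixedBy_top v u

/-- `clsOf v u = clsOf v u'` iff `u⁻¹ u'` is TORSION in `𝒪_v^×` (a root of unity). [folklore] -/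
theorem clsOf_eq_iff (u u' : (↥(v.adicCompletionIntegers F))ˣ) : clsOf v u = clsOf v u' ↔ IsOfFinOrder (u⁻¹ * u') := by
  rw [clsOf_eq_mk, clsOf_eq_mk, QuotientGroup.eq, CommGroup.mem_torsion, ← map_inv, ← map_mul]
  constructor
  · intro h
    obtain ⟨n, hn, hw⟩ := h.exists_pow_eq_one
    refine isOfFinOrder_iff_pow_eq_one.mpr ⟨n, hn, toOUnits_injective v ?_⟩
    rw [map_pow, map_one]
    exact hw
  · exact MonoidHom.isOfFinOrder (toOUnits v)

/-- **A logarithm is constant on torsion classes**: for ANY homomorphism `log_v : 𝒪_v^× → (K_v, +)`,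
`clsOf v u = clsOf v u' ⟹ log_v u = log_v u'` (`K_v` is torsion-free). [folklore] -/
theorem log_eq_of_clsOf_eq (L : Additive (↥(v.adicCompletionIntegers F))ˣ →+ v.adicCompletion F)
    {u u' : (↥(v.adicCompletionIntegers F))ˣ} (h : clsOf v u = clsOf v u') :
    L (Additive.ofMul u) = L (Additive.ofMul u') := by
  haveI := GaloisRepresentations.charZero_adicCompletion v
  rw [clsOf_eq_iff] at h
  obtain ⟨n, hn, hpow⟩ := h.exists_pow_eq_one
  have hz : (n : v.adicCompletion F) * L (Additive.ofMul (u⁻¹ * u')) = 0 := by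
    rw [← nsmul_eq_mul, ← map_nsmul, ← ofMul_pow, hpow, ofMul_one, map_zero]
  have hn0 : (n : v.adicCompletion F) ≠ 0 := by exact_mod_cast hn.ne'
  have h0 : L (Additive.ofMul (u⁻¹ * u')) = 0 := (mul_eq_zero.mp hz).resolve_left hn0
  rw [ofMul_mul, ofMul_inv, map_add, map_neg, neg_add_eq_zero] at h0
  exact h0

end Units

/-! ## 3. Realisation on `K_v`, print's (Ind2)-group, and `⊆ Aut_{ℚ_p}(K_v : I_v)` -/

section Realisation

variable (v : HeightOneSpectrum (𝓞 F)) (L : Additive (↥(v.adicCompletionIntegers F))ˣ →+ v.adicCompletion F)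

/-- **"`ψ` is induced by `φ` through `log_v`"**: for `φ ∈ Aut(O^{×μ}(G_v))` and a `ℚ`-linear `ψ : K_v ⥲ K_v`, whenever
`φ` carries the class of `u ∈ 𝒪_v^×` to the class of `u' ∈ 𝒪_v^×`, `ψ` carries `log_v u` to `log_v u'` — the passage
`Ism ↷ O^{×μ}(G_v) ⊇ O^{×μ}(G_v)^{G_v} ≅ 𝒪_v^×⧸μ` and `log(†𝒟⊢_v) = {G_v ↷ k~(G_v)} ⊇ ℐ(G_v)` of [IUTchIII] Prop. 1.2 (vi)
/ [AbsTopIII] Prop. 5.8 (ii) (the `G_v`-invariants of `k~ ≅ (K̄_v,+)` are `K_v`, abc-iut-L4 `fixed_algebraicClosure_iff`).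
A predicate with parameters (no fact). [claim: Mochizuki2012, status: disputed] -/
def Realises (φ : MulAut (ModTorsion (OUnits v))) (ψ : v.adicCompletion F ≃+ v.adicCompletion F) : Prop :=
  ∀ u u' : (↥(v.adicCompletionIntegers F))ˣ, φ (clsOf v u) = clsOf v u' → ψ (L (Additive.ofMul u)) = L (Additive.ofMul u')

/-- **PRINT'S (Ind2)-GROUP AT A FINITE PLACE `v`**, over a logarithm `L` ([IUTchIII] Thm. 3.11 (i) (Ind2), p. 154 l.
55–60; Prop. 1.2 (vi); [IUTchII] Ex. 1.8 (iv)): the bicontinuous `ℚ`-linear automorphisms of `K_v` INDUCED by a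
`G_v`-isometry `φ ∈ Ism(G_v)` of `O^{×μ}(G_v)` (continuity = print's "automorphisms of the IND-TOPOLOGICAL module");
as ADDITIVE automorphisms here (they are `ℚ`-linear automatically, `map_inv_natCast_mul`; §4 reads them `ℚ`-linearly
on c312-5's carrier). [claim: Mochizuki2012, status: disputed] -/
def ismIsmOf : Set (v.adicCompletion F ≃+ v.adicCompletion F) :=
  {ψ | Continuous ψ ∧ Continuous ψ.symm ∧ ∃ φ ∈ ismGenuine v, Realises v L φ ψ}

/-- The identity realises the identity isometry. [folklore] -/
theorem realises_one_refl : Realises v L 1 (AddEquiv.refl _) := fun _ _ h =>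
  log_eq_of_clsOf_eq v L (by rwa [MulAut.one_apply] at h)

/-- `1 ∈` print's (Ind2)-group. [folklore] -/
theorem refl_mem_ismIsmOf : AddEquiv.refl (v.adicCompletion F) ∈ ismIsmOf v L :=
  ⟨continuous_id, continuous_id, 1, (ismGenuine v).one_mem, realises_one_refl v L⟩

/-- Negation realises the inversion isometry `invAut` (`[u] ↦ [u]⁻¹ = [u⁻¹]`, `log_v u⁻¹ = − log_v u`).
[claim: Mochizuki2012, status: disputed] -/
theorem realises_invAut_neg : Realises v L (invAut _) (AddEquiv.neg (v.adicCompletion F)) := by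
  intro u u' h
  rw [invAut_apply, ← clsOf_inv] at h
  rw [AddEquiv.neg_apply, ← log_eq_of_clsOf_eq v L h, ofMul_inv, map_neg]

/-- **NON-VACUITY: `−1 ∈` print's (Ind2)-group at every finite place** — the inversion of `O^{×μ}(G_v)` is a
`G_v`-isometry (`invAut_mem_isometryGroup`; the image of `−1 ∈ Ẑ^×` under [IUTchII] Ex. 1.8 (iv)'s
"`Ẑ^× ↠ ℤ_p^× ↪ Ism`"), realised by `−1` on `K_v`; so print's (Ind2) MOVES every non-zero element of the log-shell
(as c312-5's `neg_mem_ismDH_inr` does for DH's group; no more is claimed here). [claim: Mochizuki2012, status: disputed] -/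
theorem neg_mem_ismIsmOf : AddEquiv.neg (v.adicCompletion F) ∈ ismIsmOf v L :=
  ⟨continuous_neg, continuous_neg, invAut _, invAut_mem_isometryGroup _ _, realises_invAut_neg v L⟩

/-- An ADDITIVE automorphism of `K_v` commutes with the scaling `(p_v^*)⁻¹ · (−)` of the log-shell (it is
`ℤ`-linear and `K_v` has characteristic `0`). [folklore] -/
theorem map_inv_natCast_mul (ψ : v.adicCompletion F ≃+ v.adicCompletion F) (n : ℕ) (a : v.adicCompletion F) :
    ψ (((n : ℕ) : v.adicCompletion F)⁻¹ * a) = ((n : ℕ) : v.adicCompletion F)⁻¹ * ψ a := by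
  haveI := GaloisRepresentations.charZero_adicCompletion v
  rcases Nat.eq_zero_or_pos n with rfl | hn
  · simp
  have hn0 : ((n : ℕ) : v.adicCompletion F) ≠ 0 := by exact_mod_cast hn.ne'
  have key : ((n : ℕ) : v.adicCompletion F) * ψ (((n : ℕ) : v.adicCompletion F)⁻¹ * a) = ψ a := by
    rw [← nsmul_eq_mul, ← map_nsmul, nsmul_eq_mul, ← mul_assoc, mul_inv_cancel₀ hn0, one_mul]
  rw [eq_inv_mul_iff_mul_eq₀ hn0, key]

/-- A realised isometry maps the log-shell `I_v = (p^*)⁻¹·log_v(𝒪_v^×)` INTO itself (`φ[u] ∈ φ(Im 𝒪_v^×) = Im 𝒪_v^×`,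
the lattice condition of [IUTchII] Ex. 1.8 (iv) at the open subgroup `H = G_v`). [claim: Mochizuki2012, status: disputed] -/
theorem image_shell_subset_of_realises (p : ℕ) {φ : MulAut (ModTorsion (OUnits v))} (hφ : φ ∈ ismGenuine v)
    {ψ : v.adicCompletion F ≃+ v.adicCompletion F} (hψ : Realises v L φ ψ) :
    ψ '' nonarchLogShell (v.adicCompletionIntegers F) L p ⊆ nonarchLogShell (v.adicCompletionIntegers F) L p := by
  rintro _ ⟨a, ⟨u, rfl⟩, rfl⟩
  obtain ⟨x', hx', hq⟩ := exists_fixedBy_apply_mk_of_mem_isometryGroup hφ (top_mem_openSubgroups v)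
    (toOUnits_mem_fixedBy_top v u)
  obtain ⟨u', rfl⟩ := (mem_fixedBy_top_iff v x').mp hx'
  refine ⟨u', ?_⟩
  rw [map_inv_natCast_mul, hψ u u' (by rw [clsOf_eq_mk, clsOf_eq_mk]; exact hq.symm)]

/-- … and ONTO it: `I_v ⊆ ψ(I_v)` (`φ` maps `Im 𝒪_v^×` onto itself). [claim: Mochizuki2012, status: disputed] -/
theorem shell_subset_image_of_realises (p : ℕ) {φ : MulAut (ModTorsion (OUnits v))} (hφ : φ ∈ ismGenuine v)
    {ψ : v.adicCompletion F ≃+ v.adicCompletion F} (hψ : Realises v L φ ψ) :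
    nonarchLogShell (v.adicCompletionIntegers F) L p ⊆ ψ '' nonarchLogShell (v.adicCompletionIntegers F) L p := by
  rintro a ⟨u', rfl⟩
  -- `clsOf u'` lies in the lattice `Im(O^×(G_v)^{G_v})`, which `φ` maps onto itself
  have hlat := ((mem_isometryGroup _ _ φ).mp hφ).2 ⊤ (top_mem_openSubgroups v)
  have hmem : clsOf v u' ∈ invariantLattice (galRho v) ⊤ :=
    Subgroup.mem_map.mpr ⟨_, toOUnits_mem_fixedBy_top v u', rfl⟩
  rw [← hlat] at hmem
  obtain ⟨q, hq, hφq⟩ := Subgroup.mem_map.mp hmem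
  obtain ⟨x, hx, rfl⟩ := Subgroup.mem_map.mp hq
  obtain ⟨u, rfl⟩ := (mem_fixedBy_top_iff v x).mp hx
  refine ⟨((pStar p : ℕ) : v.adicCompletion F)⁻¹ * L (Additive.ofMul u), ⟨u, rfl⟩, ?_⟩
  rw [map_inv_natCast_mul, hψ u u' (by rw [clsOf_eq_mk, clsOf_eq_mk]; exact hφq)]

/-- **A realised print isometry maps the log-shell onto itself: `ψ(I_v) = I_v`.** [claim: Mochizuki2012, status: disputed] -/
theorem image_shell_eq_of_realises (p : ℕ) {φ : MulAut (ModTorsion (OUnits v))} (hφ : φ ∈ ismGenuine v)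
    {ψ : v.adicCompletion F ≃+ v.adicCompletion F} (hψ : Realises v L φ ψ) :
    ψ '' nonarchLogShell (v.adicCompletionIntegers F) L p = nonarchLogShell (v.adicCompletionIntegers F) L p :=
  Set.Subset.antisymm (image_shell_subset_of_realises v L p hφ hψ) (shell_subset_image_of_realises v L p hφ hψ)

/-- Every element of print's (Ind2)-group maps the log-shell onto itself. [claim: Mochizuki2012, status: disputed] -/
theorem image_shell_eq_of_mem_ismIsmOf (p : ℕ) {ψ : v.adicCompletion F ≃+ v.adicCompletion F}
    (hψ : ψ ∈ ismIsmOf v L) :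
    ψ '' nonarchLogShell (v.adicCompletionIntegers F) L p = nonarchLogShell (v.adicCompletionIntegers F) L p := by
  obtain ⟨-, -, φ, hφ, hr⟩ := hψ
  exact image_shell_eq_of_realises v L p hφ hr

end Realisation

end Summit.ABC.IUTFork.Thm311.Real

end
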